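import Mathlib
import Summits.NavierStokesRegularity.NavierStokesRegularity.Theorems.ThreadingFluxHorizonTowerSecondDigit
import HarnessLib

/-!
# Crux `PoloidalLiouville` (stmt-NavierStokesRegularity-1222), crux idea «horizon-threading-tower» (ns-idea-15):
# THE THIRD CONE DIGIT — Leibniz closed forms in general degree for shells generated by one harmonic quadratic

Support file (`--supports stmt-NavierStokesRegularity-1222`, helper; cell `ns-wall-extremal`, width hand ns-wall-eng-3 g6; 0 kit), toward
THM J «a finite tower whose top pair `(D′, D) = (2(m+2), 2(n+2))` has `m + 2 ⊥ n + 2` (gcd 2), WITH the competitor shell of degree `D′ − 2`,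
is coaxially zonal at order one».

`L = xᵀQx` (`genL`), `M = |Qx|²`, `W = det(x,Qx,Q²x)`, `ρ = |x|²`, `τ = tr Q²`, `δ = det Q`; `{·,·} = detP`.  All identities are stated
for EVERY `m : ℕ`, multiplied by the power of `L` that makes natural-number exponents unnecessary (the third digit is read after
multiplication by `L²`, which the chart argument tolerates):
* `genL_mul_dotP_genL_pow`: `L·∇L·∇(L^m) = 4m L^m M`;  `genL_mul_lapP_genL_pow_succ`: `L·Δ(L^{m+1}) = 4(m+1)m L^m M`;
* ★ `genL_sq_mul_lapP_genL_pow_mul_genM`: `L²·Δ(L^m M) = (4m+2)τ L^{m+2} + 4m(m−1) L^m M² + 8mδ ρ L^{m+1}`;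
* brackets with the generator: `{L^m, L} = 0`, `{L^m M, L} = −4L^m W`, `{M², L} = −8MW`, `{ρX, L} = ρ{X, L}`,
  `L²{Δ(L^m M), L} = −32m(m−1) L^m M W`, `L{Δ(L^{m+1}), L} = −16(m+1)m L^m W`, `{L^{m+1}, L^n M} = 4(m+1) L^{m+n} W`,
  ★ `L²{L^m M, L^n M} = 4(m−n) L^{m+n+1} M W`;
* ★ SECOND-ORDER REMAINDER (`lapP_remainder`, `exists_detP_genL_lapP_remainder`): if `(8k+14)G = A·L^k M − ρΔG` (the harmonic remainder
  of `…SecondDigit`) then `(16k+20)ΔG = A·Δ(L^k M) − ρΔ²G` and `(16k+20)·L²{L, ΔG} ≡ 32A k(k−1) L^k M W (mod ρ)`;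
* ★ `thirdDigit_numerator_ne_zero`: the digit-3 numerator `N(m,n) ≠ 0` for `m < n` (all coefficients of `−N(m,m+d+1)` positive);
* ★ the mod-`ρ` brackets the third digit needs (`exists_detP_remainders`, `exists_detP_competitor_remainder`,
  `exists_detP_competitor_top`, `exists_detP_genL_competitorRemainder`): `{G₁,G₂}`, `{P_c, G₂}`, `{P_c, P_{D′}}`, `{G_c, L}` for the confined
  competitor `u·P_c = κ₀L^{m+1} + κ₁L^m M + ρG_c`.

HONEST LABEL: polynomial algebra about one crux idea's typed objects; no Prop of the sketch is closed here; `HorizonTowerZonality`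
(general towers), `PoloidalLiouville` (1222) OPEN; NS regularity NOT proved.  [folklore]
-/

-- the summit and its single sub-problem share the name (CONVENTIONS §1)
set_option linter.dupNamespace false
-- `simp only` closers over `C`-coefficients are import-order sensitive (simprocs); keep the lists explicit, silence the arg linter
set_option linter.unusedSimpArgs false

noncomputable section

open MvPolynomial

namespace Summit.NavierStokesRegularity.NavierStokesRegularity.Theorems.PoloidalLiouville.HorizonTower.Zonal

section Real

variable (a b d e f : ℝ)

/-! ### Flat calculus of `L^m` and `L^m M` in every degree -/

/-- `L · ∇L·∇(L^m) = 4m · L^m M` for every `m`. [folklore] -/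
theorem genL_mul_dotP_genL_pow (m : ℕ) :
    genL a b d e f * dotP (genL a b d e f) (genL a b d e f ^ m) = C (4 * (m : ℝ)) * genL a b d e f ^ m * genM a b d e f := by
  cases m with
  | zero => rw [pow_zero, ← C_1, dotP_C_right]; simp
  | succ k =>
    rw [dotP_genL_pow]
    simp only [map_mul, map_add, map_natCast, map_one, map_ofNat, Nat.cast_succ]
    ring

/-- `L · Δ(L^{m+1}) = 4(m+1)m · L^m M` for every `m`. [folklore] -/
theorem genL_mul_lapP_genL_pow_succ (m : ℕ) :
    genL a b d e f * lapP (genL a b d e f ^ (m + 1)) = C (4 * ((m : ℝ) + 1) * m) * genL a b d e f ^ m * genM a b d e f := by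
  cases m with
  | zero => rw [zero_add, pow_one, lapP_genL]; simp
  | succ k =>
    rw [show k + 1 + 1 = k + 2 by ring, lapP_genL_pow]
    simp only [map_mul, map_add, map_natCast, map_one, map_ofNat, Nat.cast_succ]
    ring

/-- ★ `L² · Δ(L^m M) = (4m+2)τ · L^{m+2} + 4m(m−1) · L^m M² + 8mδ · ρ L^{m+1}` for every `m`. [folklore] -/
theorem genL_sq_mul_lapP_genL_pow_mul_genM (m : ℕ) :
    genL a b d e f ^ 2 * lapP (genL a b d e f ^ m * genM a b d e f)
      = C ((4 * (m : ℝ) + 2) * genTau a b d e f) * genL a b d e f ^ (m + 2)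
        + C (4 * (m : ℝ) * ((m : ℝ) - 1)) * genL a b d e f ^ m * genM a b d e f ^ 2
        + C (8 * (m : ℝ) * genDelta a b d e f) * normSq * genL a b d e f ^ (m + 1) := by
  induction m with
  | zero =>
    rw [pow_zero, one_mul, lapP_genM]
    simp only [map_mul, map_add, map_sub, map_ofNat, Nat.cast_zero, map_zero, map_one]
    ring
  | succ k ih =>
    have h1 := genL_mul_dotP_genL_pow a b d e f k
    have hexp : lapP (genL a b d e f ^ (k + 1) * genM a b d e f)
        = genL a b d e f * lapP (genL a b d e f ^ k * genM a b d e f)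
          + C 2 * (genL a b d e f ^ k * dotP (genL a b d e f) (genM a b d e f)
            + genM a b d e f * dotP (genL a b d e f) (genL a b d e f ^ k)) := by
      rw [show genL a b d e f ^ (k + 1) * genM a b d e f = genL a b d e f * (genL a b d e f ^ k * genM a b d e f) by ring,
        lapP_mul, lapP_genL, dotP_mul_right]
      ring
    rw [hexp, dotP_genL_genM]
    simp only [map_mul, map_add, map_sub, map_ofNat, map_natCast, Nat.cast_succ, map_one] at ih h1 ⊢
    linear_combination genL a b d e f * ih + 2 * genL a b d e f * genM a b d e f * h1

/-! ### Brackets with the generator -/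

/-- `{L^m, L} = 0`. [folklore] -/
theorem detP_genL_pow_genL (m : ℕ) : detP (genL a b d e f ^ m) (genL a b d e f) = 0 := by
  rw [detP_antisymm, detP_pow_self, neg_zero]

/-- `{L^m M, L} = −4 L^m W`. [folklore] -/
theorem detP_genL_pow_mul_genM_genL (m : ℕ) :
    detP (genL a b d e f ^ m * genM a b d e f) (genL a b d e f) = -(C 4 * genL a b d e f ^ m * genW a b d e f) := by
  rw [detP_mul_left, detP_genM_genL, detP_genL_pow_genL]; ring

/-- `{M², L} = −8 M W`. [folklore] -/
theorem detP_genM_sq_genL : detP (genM a b d e f ^ 2) (genL a b d e f) = -(C 8 * genM a b d e f * genW a b d e f) := by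
  rw [pow_two, detP_mul_left, detP_genM_genL]; simp only [map_ofNat]; ring

/-- `{ρX, L} = ρ{X, L}`. [folklore] -/
theorem detP_normSq_mul_genL (X : RPoly) : detP (normSq * X) (genL a b d e f) = normSq * detP X (genL a b d e f) := by
  rw [detP_mul_left, detP_normSq_left, mul_zero, add_zero]

/-- `{X, ρY} = ρ{X, Y}`. [folklore] -/
theorem detP_normSq_mul_right' (X Y : RPoly) : detP X (normSq * Y) = normSq * detP X Y := by
  rw [detP_mul_right, detP_normSq_right, mul_zero, add_zero]

/-- `{ρX, Y} = ρ{X, Y}`. [folklore] -/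
theorem detP_normSq_mul_left' (X Y : RPoly) : detP (normSq * X) Y = normSq * detP X Y := by
  rw [detP_mul_left, detP_normSq_left, mul_zero, add_zero]

/-- `L² · {Δ(L^m M), L} = −32m(m−1) · L^m M W`. [folklore] -/
theorem genL_sq_mul_detP_lapP_genL_pow_mul_genM_genL (m : ℕ) :
    genL a b d e f ^ 2 * detP (lapP (genL a b d e f ^ m * genM a b d e f)) (genL a b d e f)
      = -(C (32 * (m : ℝ) * ((m : ℝ) - 1)) * genL a b d e f ^ m * genM a b d e f * genW a b d e f) := by
  have h := genL_sq_mul_lapP_genL_pow_mul_genM a b d e f m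
  have h1 : detP (genL a b d e f ^ 2 * lapP (genL a b d e f ^ m * genM a b d e f)) (genL a b d e f)
      = genL a b d e f ^ 2 * detP (lapP (genL a b d e f ^ m * genM a b d e f)) (genL a b d e f) := by
    rw [detP_mul_left, detP_genL_pow_genL, mul_zero, add_zero]
  rw [← h1, h]
  simp only [detP_add_left, detP_mul_left, detP_C_left, detP_genL_pow_genL, detP_normSq_left, detP_genM_sq_genL, mul_zero,
    add_zero, zero_add]
  simp only [map_mul, map_sub, map_ofNat, map_natCast, map_one]
  ring

/-- `L · {Δ(L^{m+1}), L} = −16(m+1)m · L^m W`. [folklore] -/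
theorem genL_mul_detP_lapP_genL_pow_succ_genL (m : ℕ) :
    genL a b d e f * detP (lapP (genL a b d e f ^ (m + 1))) (genL a b d e f)
      = -(C (16 * ((m : ℝ) + 1) * m) * genL a b d e f ^ m * genW a b d e f) := by
  have h := genL_mul_lapP_genL_pow_succ a b d e f m
  have h1 : detP (genL a b d e f * lapP (genL a b d e f ^ (m + 1))) (genL a b d e f)
      = genL a b d e f * detP (lapP (genL a b d e f ^ (m + 1))) (genL a b d e f) := by
    rw [detP_mul_left, detP_self, mul_zero, add_zero]
  rw [← h1, h]
  simp only [detP_mul_left, detP_C_left, detP_genL_pow_genL, detP_genM_genL, mul_zero, add_zero]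
  simp only [map_mul, map_add, map_ofNat, map_natCast, map_one]
  ring

/-- `{L^{m+1}, L^n M} = 4(m+1) · L^{m+n} W`. [folklore] -/
theorem detP_genL_pow_succ_genL_pow_mul_genM (m n : ℕ) :
    detP (genL a b d e f ^ (m + 1)) (genL a b d e f ^ n * genM a b d e f)
      = C (4 * ((m : ℝ) + 1)) * genL a b d e f ^ (m + n) * genW a b d e f := by
  rw [detP_mul_right, detP_pow_left, detP_pow_left, detP_genL_genM, detP_pow_self]
  simp only [map_mul, map_add, map_ofNat, map_natCast, map_one]
  ring

/-- ★ `L² · {L^m M, L^n M} = 4(m−n) · L^{m+n+1} M W`. [folklore] -/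
theorem genL_sq_mul_detP_genL_pow_mul_genM (m n : ℕ) :
    genL a b d e f ^ 2 * detP (genL a b d e f ^ m * genM a b d e f) (genL a b d e f ^ n * genM a b d e f)
      = C (4 * ((m : ℝ) - n)) * genL a b d e f ^ (m + n + 1) * genM a b d e f * genW a b d e f := by
  -- `L{X, L^n} = n L^n {X, L}` and `L{L^m, X} = m L^m {L, X}` for every `m, n`
  have hr : ∀ (X : RPoly) (k : ℕ), genL a b d e f * detP X (genL a b d e f ^ k)
      = C (k : ℝ) * genL a b d e f ^ k * detP X (genL a b d e f) := by
    intro X k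
    cases k with
    | zero => rw [pow_zero, ← C_1, detP_C_right]; simp
    | succ j =>
      rw [detP_pow_right]; simp only [map_add, map_natCast, map_one, Nat.cast_succ]; ring
  have hl : ∀ (X : RPoly) (k : ℕ), genL a b d e f * detP (genL a b d e f ^ k) X
      = C (k : ℝ) * genL a b d e f ^ k * detP (genL a b d e f) X := by
    intro X k
    rw [detP_antisymm, mul_neg, hr, detP_antisymm X]; ring
  have h1 := hr (genM a b d e f) n
  have h2 := hl (genM a b d e f) m
  have h3 : genL a b d e f ^ 2 * detP (genL a b d e f ^ m) (genL a b d e f ^ n) = 0 := by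
    rw [pow_two, mul_assoc, hl, mul_assoc, detP_pow_self, mul_zero, mul_zero, mul_zero]
  rw [detP_genM_genL] at h1
  rw [detP_genL_genM] at h2
  rw [detP_mul_left, detP_mul_right, detP_mul_right, detP_self, mul_zero, zero_add]
  simp only [map_mul, map_sub, map_ofNat, map_natCast] at h1 h2 ⊢
  linear_combination genL a b d e f ^ (m + 1) * genM a b d e f * h1 + genL a b d e f ^ (n + 1) * genM a b d e f * h2
    + genM a b d e f ^ 2 * h3

/-! ### The second-order harmonic remainder -/

/-- `Δ` of a homogeneous polynomial of degree `k` is homogeneous of degree `k − 2`. [folklore] -/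
theorem isHomogeneous_lapP {R : Type*} [CommRing R] {G : MvPolynomial (Fin 3) R} {k : ℕ} (hG : G.IsHomogeneous k) :
    (lapP G).IsHomogeneous (k - 2) := by
  have h : ∀ i : Fin 3, (pderiv i (pderiv i G)).IsHomogeneous (k - 2) := by
    intro i
    have := (hG.pderiv (i := i)).pderiv (i := i)
    rwa [show k - 1 - 1 = k - 2 by omega] at this
  unfold lapP
  exact ((h 0).add (h 1)).add (h 2)

/-- ★ **SECOND-ORDER REMAINDER.**  If `(8k+14)G = A·L^k M − ρΔG` with `G` homogeneous of degree `2k + 2` (the harmonic remainder of a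
shell `γL^{k+2} + ρG`, `…SecondDigit`), then `(16k+20)ΔG = A·Δ(L^k M) − ρ·Δ²G`. [folklore] -/
theorem lapP_remainder {G : RPoly} {A : ℝ} {k : ℕ} (hG : G.IsHomogeneous (2 * k + 2))
    (h : C (8 * (k : ℝ) + 14) * G = C A * genL a b d e f ^ k * genM a b d e f - normSq * lapP G) :
    C (16 * (k : ℝ) + 20) * lapP G = C A * lapP (genL a b d e f ^ k * genM a b d e f) - normSq * lapP (lapP G) := by
  have hΔ : (lapP G).IsHomogeneous (2 * k) := by
    have := isHomogeneous_lapP hG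
    rwa [show 2 * k + 2 - 2 = 2 * k by omega] at this
  have h1 := congrArg lapP h
  rw [lapP_C_mul, lapP_sub, mul_assoc, lapP_C_mul, lapP_normSq_mul_of_isHomogeneous hΔ] at h1
  simp only [map_mul, map_add, map_ofNat, map_natCast, Nat.cast_mul, Nat.cast_ofNat] at h1 ⊢
  linear_combination h1

/-- ★ `(16k+20) · L² · {L, ΔG} = 32A·k(k−1) · L^k M W + ρ·J` under the same hypothesis. [folklore] -/
theorem exists_detP_genL_lapP_remainder {G : RPoly} {A : ℝ} {k : ℕ} (hG : G.IsHomogeneous (2 * k + 2))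
    (h : C (8 * (k : ℝ) + 14) * G = C A * genL a b d e f ^ k * genM a b d e f - normSq * lapP G) :
    ∃ J : RPoly, C (16 * (k : ℝ) + 20) * (genL a b d e f ^ 2 * detP (genL a b d e f) (lapP G))
      = C (32 * A * (k : ℝ) * ((k : ℝ) - 1)) * genL a b d e f ^ k * genM a b d e f * genW a b d e f + normSq * J := by
  have h1 := lapP_remainder a b d e f hG h
  have h2 := genL_sq_mul_detP_lapP_genL_pow_mul_genM_genL a b d e f k
  refine ⟨-(genL a b d e f ^ 2 * detP (genL a b d e f) (lapP (lapP G))), ?_⟩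
  have h3 : C (16 * (k : ℝ) + 20) * (genL a b d e f ^ 2 * detP (genL a b d e f) (lapP G))
      = genL a b d e f ^ 2 * detP (genL a b d e f) (C (16 * (k : ℝ) + 20) * lapP G) := by
    rw [detP_C_mul_right]; ring
  rw [h3, h1, detP_sub_right, detP_C_mul_right, detP_normSq_mul_right', detP_antisymm (lapP _) (genL a b d e f)]
  simp only [map_mul, map_sub, map_ofNat, map_natCast, map_one] at h2 ⊢
  linear_combination (-1 : RPoly) * C A * h2

/-! ### The mod-`ρ` brackets of the third digit -/

/-- ★ `{G₁, G₂}` modulo `ρ` for two harmonic remainders: `(8m+14)(8n+14) · L² · {G₁,G₂} = 4(m−n)A₁A₂ · L^{m+n+1} M W + ρ·J`. [folklore] -/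
theorem exists_detP_remainders {G₁ G₂ : RPoly} {A₁ A₂ : ℝ} {m n : ℕ}
    (h₁ : C (8 * (m : ℝ) + 14) * G₁ = C A₁ * genL a b d e f ^ m * genM a b d e f - normSq * lapP G₁)
    (h₂ : C (8 * (n : ℝ) + 14) * G₂ = C A₂ * genL a b d e f ^ n * genM a b d e f - normSq * lapP G₂) :
    ∃ J : RPoly, C ((8 * (m : ℝ) + 14) * (8 * (n : ℝ) + 14)) * (genL a b d e f ^ 2 * detP G₁ G₂)
      = C (4 * ((m : ℝ) - n) * A₁ * A₂) * genL a b d e f ^ (m + n + 1) * genM a b d e f * genW a b d e f + normSq * J := by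
  have hk := genL_sq_mul_detP_genL_pow_mul_genM a b d e f m n
  have h3 : C ((8 * (m : ℝ) + 14) * (8 * (n : ℝ) + 14)) * (genL a b d e f ^ 2 * detP G₁ G₂)
      = genL a b d e f ^ 2 * detP (C (8 * (m : ℝ) + 14) * G₁) (C (8 * (n : ℝ) + 14) * G₂) := by
    rw [detP_C_mul_left, detP_C_mul_right, map_mul]; ring
  refine ⟨-(C A₁ * genL a b d e f ^ 2 * detP (genL a b d e f ^ m * genM a b d e f) (lapP G₂))
      - C A₂ * genL a b d e f ^ 2 * detP (lapP G₁) (genL a b d e f ^ n * genM a b d e f)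
      + normSq * genL a b d e f ^ 2 * detP (lapP G₁) (lapP G₂), ?_⟩
  have h₁' : C (8 * (m : ℝ) + 14) * G₁ = C A₁ * (genL a b d e f ^ m * genM a b d e f) - normSq * lapP G₁ := by
    rw [h₁]; ring
  have h₂' : C (8 * (n : ℝ) + 14) * G₂ = C A₂ * (genL a b d e f ^ n * genM a b d e f) - normSq * lapP G₂ := by
    rw [h₂]; ring
  rw [h3, h₁', h₂', detP_sub_left, detP_sub_right, detP_sub_right, detP_C_mul_left, detP_C_mul_left, detP_C_mul_right,
    detP_C_mul_right, detP_normSq_mul_left', detP_normSq_mul_left', detP_normSq_mul_right', detP_normSq_mul_right']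
  simp only [map_mul, map_sub, map_ofNat, map_natCast] at hk ⊢
  linear_combination C A₁ * C A₂ * hk

/-- ★ `{P_c, G₂}` modulo `ρ` for the CONFINED COMPETITOR `P_c = κ₀L^{m+1} + κ₁L^m M + ρG_c` and a harmonic remainder `G₂`:
`(8n+14) · L² · {P_c, G₂} = 4(m+1)κ₀A₂ · L^{m+n+2} W + 4(m−n)κ₁A₂ · L^{m+n+1} M W + ρ·J`. [folklore] -/
theorem exists_detP_competitor_remainder {Pc Gc G₂ : RPoly} {κ₀ κ₁ A₂ : ℝ} {m n : ℕ}
    (hPc : Pc = C κ₀ * genL a b d e f ^ (m + 1) + C κ₁ * genL a b d e f ^ m * genM a b d e f + normSq * Gc)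
    (h₂ : C (8 * (n : ℝ) + 14) * G₂ = C A₂ * genL a b d e f ^ n * genM a b d e f - normSq * lapP G₂) :
    ∃ J : RPoly, C (8 * (n : ℝ) + 14) * (genL a b d e f ^ 2 * detP Pc G₂)
      = C (4 * ((m : ℝ) + 1) * κ₀ * A₂) * genL a b d e f ^ (m + n + 2) * genW a b d e f
        + C (4 * ((m : ℝ) - n) * κ₁ * A₂) * genL a b d e f ^ (m + n + 1) * genM a b d e f * genW a b d e f + normSq * J := by
  have hk := genL_sq_mul_detP_genL_pow_mul_genM a b d e f m n
  have hj := detP_genL_pow_succ_genL_pow_mul_genM a b d e f m n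
  have h3 : C (8 * (n : ℝ) + 14) * (genL a b d e f ^ 2 * detP Pc G₂)
      = genL a b d e f ^ 2 * detP Pc (C (8 * (n : ℝ) + 14) * G₂) := by
    rw [detP_C_mul_right]; ring
  refine ⟨C A₂ * genL a b d e f ^ 2 * detP Gc (genL a b d e f ^ n * genM a b d e f) - genL a b d e f ^ 2 * detP Pc (lapP G₂), ?_⟩
  have h₂' : C (8 * (n : ℝ) + 14) * G₂ = C A₂ * (genL a b d e f ^ n * genM a b d e f) - normSq * lapP G₂ := by
    rw [h₂]; ring
  have hmain : detP Pc (genL a b d e f ^ n * genM a b d e f)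
      = C κ₀ * detP (genL a b d e f ^ (m + 1)) (genL a b d e f ^ n * genM a b d e f)
        + C κ₁ * detP (genL a b d e f ^ m * genM a b d e f) (genL a b d e f ^ n * genM a b d e f)
        + normSq * detP Gc (genL a b d e f ^ n * genM a b d e f) := by
    rw [hPc, detP_add_left, detP_add_left, detP_C_mul_left,
      show C κ₁ * genL a b d e f ^ m * genM a b d e f = C κ₁ * (genL a b d e f ^ m * genM a b d e f) by ring, detP_C_mul_left,
      detP_normSq_mul_left']
  rw [h3, h₂', detP_sub_right, detP_C_mul_right, detP_normSq_mul_right', hmain, hj]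
  simp only [map_mul, map_add, map_sub, map_ofNat, map_natCast, map_one] at hk ⊢
  linear_combination C A₂ * C κ₁ * hk

/-- ★ `{P_c, P_{D′}}` modulo `ρ` for the confined competitor and the second shell `P_{D′} = g₁L^{m+2} + ρG₁`:
`{P_c, P_{D′}} = −4(m+2)κ₁g₁ · L^{2m+1} W + ρ·J`. [folklore] -/
theorem exists_detP_competitor_top {Pc Gc P₁ G₁ : RPoly} {κ₀ κ₁ g₁ : ℝ} {m : ℕ}
    (hPc : Pc = C κ₀ * genL a b d e f ^ (m + 1) + C κ₁ * genL a b d e f ^ m * genM a b d e f + normSq * Gc)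
    (hP₁ : P₁ = C g₁ * genL a b d e f ^ (m + 2) + normSq * G₁) :
    ∃ J : RPoly, detP Pc P₁ = -(C (4 * ((m : ℝ) + 2) * κ₁ * g₁) * genL a b d e f ^ (2 * m + 1) * genW a b d e f) + normSq * J := by
  refine ⟨detP Pc G₁ + C g₁ * detP Gc (genL a b d e f ^ (m + 2)), ?_⟩
  have hmain : detP Pc (genL a b d e f ^ (m + 2))
      = -(C (4 * ((m : ℝ) + 2) * κ₁) * genL a b d e f ^ (2 * m + 1) * genW a b d e f)
        + normSq * detP Gc (genL a b d e f ^ (m + 2)) := by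
    rw [hPc, detP_add_left, detP_add_left, detP_C_mul_left,
      show C κ₁ * genL a b d e f ^ m * genM a b d e f = C κ₁ * (genL a b d e f ^ m * genM a b d e f) by ring, detP_C_mul_left,
      detP_normSq_mul_left', show m + 2 = (m + 1) + 1 by ring, detP_pow_right _ _ (m + 1), detP_pow_right _ _ (m + 1),
      detP_genL_pow_genL, detP_genL_pow_mul_genM_genL]
    simp only [map_mul, map_add, map_ofNat, map_natCast, map_one, Nat.cast_succ]
    ring
  rw [hP₁, detP_add_right, detP_C_mul_right, detP_normSq_mul_right', hmain]
  simp only [map_mul, map_add, map_ofNat, map_natCast, map_one]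
  ring

/-- ★ `{G_c, L}` modulo `ρ` for the remainder of the confined HARMONIC competitor `P_c = κ₀L^{m+1} + κ₁L^m M + ρG_c` (`ΔP_c = 0`,
`G_c` homogeneous of degree `2m`): `(8m+6) · L² · {G_c, L} = 16(m+1)mκ₀ · L^{m+1} W + 32m(m−1)κ₁ · L^m M W + ρ·J`. [folklore] -/
theorem exists_detP_genL_competitorRemainder {Pc Gc : RPoly} {κ₀ κ₁ : ℝ} {m : ℕ} (hGc : Gc.IsHomogeneous (2 * m))
    (hPc : Pc = C κ₀ * genL a b d e f ^ (m + 1) + C κ₁ * genL a b d e f ^ m * genM a b d e f + normSq * Gc)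
    (hl : lapP Pc = 0) :
    ∃ J : RPoly, C (8 * (m : ℝ) + 6) * (genL a b d e f ^ 2 * detP Gc (genL a b d e f))
      = C (16 * ((m : ℝ) + 1) * m * κ₀) * genL a b d e f ^ (m + 1) * genW a b d e f
        + C (32 * (m : ℝ) * ((m : ℝ) - 1) * κ₁) * genL a b d e f ^ m * genM a b d e f * genW a b d e f + normSq * J := by
  -- the remainder relation `(8m+6) G_c = −κ₀Δ(L^{m+1}) − κ₁Δ(L^m M) − ρΔG_c`
  have hr : C (8 * (m : ℝ) + 6) * Gc = -(C κ₀ * lapP (genL a b d e f ^ (m + 1)))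
      - C κ₁ * lapP (genL a b d e f ^ m * genM a b d e f) - normSq * lapP Gc := by
    rw [hPc, lapP_add, lapP_add, lapP_C_mul, mul_assoc, lapP_C_mul, lapP_normSq_mul_of_isHomogeneous hGc] at hl
    simp only [map_mul, map_add, map_ofNat, map_natCast, Nat.cast_mul, Nat.cast_ofNat] at hl ⊢
    linear_combination hl
  have h1 := genL_mul_detP_lapP_genL_pow_succ_genL a b d e f m
  have h2 := genL_sq_mul_detP_lapP_genL_pow_mul_genM_genL a b d e f m
  have h3 : C (8 * (m : ℝ) + 6) * (genL a b d e f ^ 2 * detP Gc (genL a b d e f))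
      = genL a b d e f ^ 2 * detP (C (8 * (m : ℝ) + 6) * Gc) (genL a b d e f) := by
    rw [detP_C_mul_left]; ring
  refine ⟨-(genL a b d e f ^ 2 * detP (lapP Gc) (genL a b d e f)), ?_⟩
  rw [h3, hr, detP_sub_left, detP_sub_left, detP_normSq_mul_genL, show -(C κ₀ * lapP (genL a b d e f ^ (m + 1)))
      = C (-κ₀) * lapP (genL a b d e f ^ (m + 1)) by rw [map_neg, neg_mul], detP_C_mul_left, detP_C_mul_left]
  simp only [map_mul, map_add, map_sub, map_neg, map_ofNat, map_natCast, map_one] at h1 h2 ⊢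
  linear_combination (-(C κ₀) * genL a b d e f) * h1 - C κ₁ * h2

/-- The bracket of any `X` with a shell `P = g·L^{n+2} + ρG`, to first order: `{X, P} = g(n+2)·L^{n+1}{X, L} + ρ{X, G}`. [folklore] -/
theorem detP_genShell_right (X : RPoly) {P G : RPoly} {g : ℝ} {n : ℕ}
    (hP : P = C g * genL a b d e f ^ (n + 2) + normSq * G) :
    detP X P = C (g * ((n : ℝ) + 2)) * genL a b d e f ^ (n + 1) * detP X (genL a b d e f) + normSq * detP X G := by
  rw [hP, detP_add_right, detP_C_mul_right, show n + 2 = (n + 1) + 1 by ring, detP_pow_right, detP_normSq_mul_right']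
  simp only [map_mul, map_add, map_natCast, map_ofNat, map_one, Nat.cast_succ]
  ring

end Real

/-! ### The digit-3 numerator -/

/-- ★ The digit-3 numerator `N(m,n)` (the closed form of eng-3 g5's `k_M(m,n)` up to non-zero factors) does not vanish for `m < n`:
`N(m, m+d+1) = −(d+1)·(288m⁴ + 432m³d + 2016m³ + 144m²d² + 2304m²d + 5490m² + 612md² + 4509md + 7137m + 630d² + 3150d + 3780) < 0`.
[folklore] -/
theorem thirdDigit_numerator_ne_zero {m n : ℕ} (hmn : m < n) :
    (144 * (m : ℝ) ^ 4 * n + 180 * (m : ℝ) ^ 4 + 612 * (m : ℝ) ^ 3 * n + 675 * (m : ℝ) ^ 3 - 144 * (m : ℝ) ^ 2 * (n : ℝ) ^ 3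
      - 180 * (m : ℝ) ^ 2 * (n : ℝ) ^ 2 + 1350 * (m : ℝ) ^ 2 * n + 1350 * (m : ℝ) ^ 2 - 612 * (m : ℝ) * (n : ℝ) ^ 3
      - 1395 * (m : ℝ) * (n : ℝ) ^ 2 + 540 * (m : ℝ) * n + 1260 * (m : ℝ) - 630 * (n : ℝ) ^ 3 - 1890 * (n : ℝ) ^ 2 - 1260 * (n : ℝ))
      ≠ 0 := by
  obtain ⟨d, rfl⟩ : ∃ d, n = m + d + 1 := ⟨n - m - 1, by omega⟩
  push_cast
  have hm : (0 : ℝ) ≤ m := Nat.cast_nonneg m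
  have hd : (0 : ℝ) ≤ d := Nat.cast_nonneg d
  have hpos : (0 : ℝ) < ((d : ℝ) + 1) * (288 * (m : ℝ) ^ 4 + 432 * (m : ℝ) ^ 3 * d + 2016 * (m : ℝ) ^ 3 + 144 * (m : ℝ) ^ 2 * (d : ℝ) ^ 2
      + 2304 * (m : ℝ) ^ 2 * d + 5490 * (m : ℝ) ^ 2 + 612 * (m : ℝ) * (d : ℝ) ^ 2 + 4509 * (m : ℝ) * d + 7137 * (m : ℝ)
      + 630 * (d : ℝ) ^ 2 + 3150 * (d : ℝ) + 3780) := by positivity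
  intro h
  nlinarith [h, hpos]

end Summit.NavierStokesRegularity.NavierStokesRegularity.Theorems.PoloidalLiouville.HorizonTower.Zonal

end
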